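import Literature.AlgebraicGeometry.HodgeTheory.RestrictionImageOfCompactificationProofs
import HarnessLib

/-!
# Voisin II, Prop. 4.23 — the strictness criterion for an `r`-component boundary:
# the snc core from LEVEL-WISE residue data

Topic `Literature/AlgebraicGeometry/HodgeTheory`; second proof-side companion (theorems only, no
definitions, no named facts — D-0026) of `RestrictionImageOfCompactification.lean` (the named fact
`voisin2003_rangeRestrict_eq_of_compactification`, C. Voisin, *Hodge Theory and Complex Algebraic
Geometry II* (2003), Prop. 4.23: for `X̄` smooth projective, `U ⊂ X̄` Zariski open and `Y ⊂ U` a closed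
smooth projective subvariety, `Im(Hᵏ(U) → Hᵏ(Y)) = Im(Hᵏ(X̄) → Hᵏ(Y))`). Its first companion
`RestrictionImageOfCompactificationProofs.lean` reduces the fact to its simple-normal-crossings core
`hSNC` (`voisin2003_rangeRestrict_eq_of_compactification_of_snc`), proves the abstract strictness
criterion `range_le_range_of_hodgeType_span_gr` (a filtered map into a pure Hodge structure has the
image of its lowest weight step as soon as the higher graded pieces `W_m / W_{m-1}`, `m > k`, are
spanned by Hodge-type vectors) and packages it for the complement of ONE smooth divisor
(`range_le_range_of_residue_lifts`: two-step weight filtration `ker Res ⊆ ⊤`, four inputs).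

For a boundary `X̄ ∖ U = D₁ ∪ ⋯ ∪ D_r` with `r ≥ 2` components the weight filtration of `Hᵏ(U)` has up
to `r + 1` steps `W_k ⊆ W_{k+1} ⊆ ⋯ ⊆ W_{k+N} = Hᵏ(U)` (Deligne, *Théorie de Hodge II*, 3.2.4:
`Gr^W_{k+j} Hᵏ(U)` is a subquotient of `H^{k-j}(D^{(j)})(-j)` through the `j`-fold residue
`Gr^W_j Ω•_X̄(log D) ≅ a_{j*} Ω•_{D^{(j)}}(ε^j)[-j]`, 3.1.5), and peeling the components one at a time
does NOT reduce `hSNC` to the one-divisor packaging (the intermediate ambients `X̄ ∖ (D₁ ∪ ⋯ ∪ D_j)`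
are only quasi-projective; their `Hᵏ` is not pure, while `range_le_range_of_residue_lifts` needs a
pure `H_X`). The honest induction is on the weight LEVEL, inside the criterion; this file records it:

* `hodgeType_span_of_residue_lifts_within` — the spanning inclusion `hP` of the criterion at ONE
  level `T_lo ⊆ T_hi` of `Hᵏ(U; ℂ)`: if a real (`ℚ`-defined) residue map `Res` sends `T_hi` onto the
  complexification of a sub-Hodge structure `S` of a pure Hodge structure of weight `n`, kills into
  `T_lo`, and residues of type `F^p` lift inside `F^p ∩ T_hi`, then
  `T_hi ⊆ T_lo + Σ_p (F^p ∩ T_hi ∩ (conj F^{n-p} ∩ T_hi + T_lo))` (generalises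
  `hodgeType_span_gr_of_residue_lifts`, the case `T_hi = ⊤`, `T_lo = (ker Res)_ℂ`);
* `range_le_range_of_residue_lifts_levels` — **Prop. 4.23 (`Im ι^* ⊆ Im (ι ≫ i)^*`) for an
  `N`-level weight filtration from level-wise residue data**: levels `T 0, …, T N = ⊤` of
  `Hᵏ(U; ℂ)`, `φ_ℂ(T 0) ⊆ im f_ℂ` (`W_k = Im Hᵏ(X̄)`, Hodge II Cor. 3.2.17), `φ_ℂ(F^p) ⊆ F^p H_Y`, and
  for each level `j < N` a residue `Res j : Hᵏ(U; ℚ) → VD j` into a pure Hodge structure of weight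
  `k + j + 1` with `Res j (T (j+1)) = (S j)_ℂ` a sub-Hodge structure, `T (j+1) ∩ ker ⊆ T j`, and
  `F^p`-residues liftable inside `F^p ∩ T (j+1)`. This is the shape in which Deligne's §3.2
  (logarithmic complex of the snc pair, `Gr^W` by iterated residues, the `∂∂̄` lifting) delivers
  `hSNC` for any number of boundary components; `N = 1` is `range_le_range_of_residue_lifts`.

Everything here is abstract linear algebra on the tree's `Motives.HodgeStructure` (filtration form);
no geometry. What is NOT here: the geometric level data for an snc pair (Hodge II 3.1.5–3.2.5), i.e.
the discharge `voisin2003_rangeRestrict_eq_of_compactification_holds`.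

## References

* [DeligneHodgeII1971] P. Deligne, Théorie de Hodge II, Publ. Math. IHÉS 40 (1971), 3.1.5, 3.2.4,
  3.2.13 (ii), Thm. 2.3.5 (iii), Cor. 3.2.17.
* [VoisinHodgeII2003] C. Voisin, Hodge Theory and Complex Algebraic Geometry II, CUP 2003, §4.3.3
  Prop. 4.23 (p. 124), Thm. 4.20, §6.1.1.

#harness_tags hodge.global_invariant_cycles, hodge.stub_D
-/

noncomputable section

namespace Literature.AlgebraicGeometry.HodgeTheory

open Literature.AlgebraicGeometry.Motives (HodgeStructure MixedHodgeStructure)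
open Literature.AlgebraicGeometry.Motives.HodgeStructure
  (conj complexConj mem_complexConj conj_baseChange)
open scoped TensorProduct

universe u' v' w' x'

variable {V : Type u'} [AddCommGroup V] [Module ℚ V]
variable {VX : Type v'} [AddCommGroup VX] [Module ℚ VX]
variable {VY : Type w'} [AddCommGroup VY] [Module ℚ VY]

/-- **The spanning hypothesis of the strictness criterion at one weight level, from liftability of
residues inside `F`.** Let `T_lo, T_hi ⊆ V_ℂ` (`V = Hᵏ(U; ℚ)`; two consecutive steps
`W_{n-1} ⊆ W_n` of the weight filtration), `T_hi` stable under conjugation, `Res : V → VD` a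
`ℚ`-linear map (the `j`-fold residue, `n = k + j`) such that `Res_ℂ(T_hi) = S_ℂ` for a sub-Hodge
structure `S` of a pure Hodge structure `HD` of weight `n` on `VD` (`Gr^W_n Hᵏ(U) ↪ H^{k-j}(D^{(j)})(-j)`
modulo Gysin images, Deligne Hodge II 3.2.4 / 3.2.13 (ii)), `T_hi ∩ ker Res_ℂ ⊆ T_lo`, and (`hL`) every
residue of type `F^p` is the residue of a vector of `F^p ∩ T_hi`. Then
`T_hi ⊆ T_lo + Σ_p (F^p ∩ T_hi ∩ (conj F^{n-p} ∩ T_hi + T_lo))`: decompose `Res x = Σ_p ξ_p` into the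
Hodge components `ξ_p ∈ S_ℂ ∩ H^{p,n-p}` (`SubHodgeStructure.baseChange_le_iSup_inf`), lift `ξ_p` inside
`F^p ∩ T_hi` and — conjugating a lift of `conj ξ_p` inside `F^{n-p} ∩ T_hi` (`Res` is real) — also
inside `conj F^{n-p} ∩ T_hi`; the two lifts differ by an element of `T_hi ∩ ker Res_ℂ ⊆ T_lo`. The case
`T_hi = ⊤`, `T_lo = (ker Res)_ℂ` is the tree's `hodgeType_span_gr_of_residue_lifts`.
[cite: DeligneHodgeII1971, 3.2.4, 3.2.13 (ii) and Thm. 2.3.5 (iii)] [cite: VoisinHodgeII2003, Thm. 4.20 and Prop. 4.23 (proof)] -/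
theorem hodgeType_span_of_residue_lifts_within {n : ℤ} {VD : Type x'} [AddCommGroup VD]
    [Module ℚ VD] {HD : HodgeStructure VD n} (S : HodgeStructure.SubHodgeStructure HD)
    (Res : V →ₗ[ℚ] VD) (Thi Tlo : Submodule ℂ (ℂ ⊗[ℚ] V)) (hconj : ∀ x ∈ Thi, conj x ∈ Thi)
    (hS : S.toSubmodule.baseChange ℂ = Thi.map (Res.baseChange ℂ))
    (hlo : ∀ x ∈ Thi, Res.baseChange ℂ x = 0 → x ∈ Tlo) (F : ℤ → Submodule ℂ (ℂ ⊗[ℚ] V))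
    (hL : ∀ (p : ℤ), ∀ ξ ∈ HD.F p ⊓ Thi.map (Res.baseChange ℂ),
      ∃ x ∈ F p ⊓ Thi, Res.baseChange ℂ x = ξ) :
    Thi ≤ Tlo ⊔ ⨆ p : ℤ, F p ⊓ Thi ⊓ (complexConj (F (n - p)) ⊓ Thi ⊔ Tlo) := by
  set T : Submodule ℂ (ℂ ⊗[ℚ] V) :=
    Tlo ⊔ ⨆ p : ℤ, F p ⊓ Thi ⊓ (complexConj (F (n - p)) ⊓ Thi ⊔ Tlo) with hT
  have hkerT : ∀ z ∈ Thi, Res.baseChange ℂ z = 0 → z ∈ T := fun z hz hz0 ↦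
    Submodule.mem_sup_left (hlo z hz hz0)
  -- every vector of `T_hi` with residue in `Σ_p (S_ℂ ∩ H^{p,n-p})` lies in `T`
  have key : ∀ ξ ∈ ⨆ p : ℤ, S.toSubmodule.baseChange ℂ ⊓ HD.piece p (n - p),
      ξ ∈ Thi.map (Res.baseChange ℂ) ∧ ∀ x ∈ Thi, Res.baseChange ℂ x = ξ → x ∈ T := by
    intro ξ hξ
    refine Submodule.iSup_induction _
      (motive := fun ξ ↦ ξ ∈ Thi.map (Res.baseChange ℂ) ∧
        ∀ x ∈ Thi, Res.baseChange ℂ x = ξ → x ∈ T) hξ (fun p ξ hξp ↦ ?_) ?_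
      (fun ξ₁ ξ₂ h₁ h₂ ↦ ?_)
    · obtain ⟨hξS, hξpiece⟩ := Submodule.mem_inf.1 hξp
      have hξr : ξ ∈ Thi.map (Res.baseChange ℂ) := by rwa [← hS]
      have hξF : ξ ∈ HD.F p := HD.piece_le_F p _ hξpiece
      have hξc : conj ξ ∈ HD.F (n - p) :=
        (mem_complexConj).1 (HD.piece_le_complexConj_F p _ hξpiece)
      -- a lift inside `F^p ∩ T_hi`
      obtain ⟨xp, hxpFT, hxp⟩ := hL p ξ ⟨hξF, hξr⟩
      obtain ⟨hxpF, hxpT⟩ := Submodule.mem_inf.1 hxpFT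
      -- a lift inside `conj F^{n-p} ∩ T_hi`: conjugate a lift of `conj ξ`
      have hξr' : conj ξ ∈ Thi.map (Res.baseChange ℂ) :=
        ⟨conj xp, hconj xp hxpT, by rw [← conj_baseChange, hxp]⟩
      obtain ⟨yp, hypFT, hyp⟩ := hL (n - p) (conj ξ) ⟨hξc, hξr'⟩
      obtain ⟨hypF, hypT⟩ := Submodule.mem_inf.1 hypFT
      have hyp' : Res.baseChange ℂ (conj yp) = ξ := by
        rw [← conj_baseChange, hyp, HodgeStructure.conj_conj]
      have hxT : xp ∈ T := by
        refine Submodule.mem_sup_right (Submodule.mem_iSup_of_mem p ?_)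
        refine Submodule.mem_inf.2 ⟨Submodule.mem_inf.2 ⟨hxpF, hxpT⟩, ?_⟩
        have hsplit : xp = conj yp + (xp - conj yp) := by abel
        rw [hsplit]
        refine Submodule.add_mem_sup (Submodule.mem_inf.2 ⟨?_, hconj yp hypT⟩)
          (hlo _ (Thi.sub_mem hxpT (hconj yp hypT)) ?_)
        · rw [mem_complexConj, HodgeStructure.conj_conj]
          exact hypF
        · rw [map_sub, hxp, hyp', sub_self]
      refine ⟨hξr, fun x hxT' hx ↦ ?_⟩
      have hsplit : x = xp + (x - xp) := by abel
      rw [hsplit]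
      exact T.add_mem hxT
        (hkerT _ (Thi.sub_mem hxT' hxpT) (by rw [map_sub, hx, hxp, sub_self]))
    · exact ⟨zero_mem _, fun x hx hx0 ↦ hkerT x hx hx0⟩
    · obtain ⟨⟨x₁, hx₁T, hx₁⟩, h₁T⟩ := h₁
      obtain ⟨h₂r, h₂T⟩ := h₂
      refine ⟨add_mem ⟨x₁, hx₁T, hx₁⟩ h₂r, fun x hxT' hx ↦ ?_⟩
      have hsplit : x = x₁ + (x - x₁) := by abel
      rw [hsplit]
      exact T.add_mem (h₁T x₁ hx₁T hx₁)
        (h₂T _ (Thi.sub_mem hxT' hx₁T) (by rw [map_sub, hx, hx₁, add_sub_cancel_left]))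
  -- conclude: the residue of any vector of `T_hi` decomposes into Hodge components inside `S_ℂ`
  intro x hx
  have hRx : Res.baseChange ℂ x ∈ ⨆ p : ℤ, S.toSubmodule.baseChange ℂ ⊓ HD.piece p (n - p) :=
    S.baseChange_le_iSup_inf (by rw [hS]; exact ⟨x, hx, rfl⟩)
  exact (key _ hRx).2 x hx rfl

/-- **Prop. 4.23 for an `N`-level weight filtration, reduced to level-wise residue data** (the
`r`-component form of `range_le_range_of_residue_lifts`; assembly of
`range_le_range_of_hodgeType_span_gr` and `hodgeType_span_of_residue_lifts_within`). Data, for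
`Y →ι U →i X̄` with `X̄ ∖ U` an snc divisor: `f = (ι ≫ i)^* : Hᵏ(X̄) → Hᵏ(Y)` a morphism of pure Hodge
structures of weight `k`, `φ = ι^* : V = Hᵏ(U; ℚ) → Hᵏ(Y; ℚ)`, subspaces `F^p ⊆ V_ℂ` with
`φ_ℂ(F^p) ⊆ F^p H_Y` (`hF`), levels `T 0, …, T N = ⊤` of `V_ℂ` (`T j = W_{k+j} Hᵏ(U; ℂ)`), the
positive ones stable under conjugation (`hconj`), with `φ_ℂ(T 0) ⊆ im f_ℂ` (`hT0`: `W_k = Im i^*`,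
Hodge II Cor. 3.2.17), and
for every level `j < N` a `ℚ`-linear `Res j : V → VD j` into a pure Hodge structure `HD j` of weight
`k + j + 1` with `Res j (T (j+1)) = (S j)_ℂ` for a sub-Hodge structure `S j` (`hS`; Hodge II 3.2.4:
`Gr^W_{k+j+1}` is a subquotient of `H^{k-j-1}(D^{(j+1)})(-j-1)`), `T (j+1) ∩ ker (Res j)_ℂ ⊆ T j` (`hlo`)
and residues of type `F^p` liftable inside `F^p ∩ T (j+1)` (`hL`, Deligne's `∂∂̄` step). Then
`Im φ ⊆ Im f`. With `N = 1`, `T 0 = (ker Res)_ℂ`, `T 1 = ⊤` this is `range_le_range_of_residue_lifts`.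
[cite: DeligneHodgeII1971, 3.2.4, Cor. 3.2.17 and Thm. 2.3.5 (iii)] [cite: VoisinHodgeII2003, Prop. 4.23 and Thm. 4.20] -/
theorem range_le_range_of_residue_lifts_levels {k : ℤ} {HX : HodgeStructure VX k}
    {HY : HodgeStructure VY k} (f : HodgeStructure.Hom HX HY) (φ : V →ₗ[ℚ] VY)
    (F : ℤ → Submodule ℂ (ℂ ⊗[ℚ] V)) (hF : ∀ p, (F p).map (φ.baseChange ℂ) ≤ HY.F p)
    {N : ℕ} (T : ℕ → Submodule ℂ (ℂ ⊗[ℚ] V))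
    (hT0 : (T 0).map (φ.baseChange ℂ) ≤ LinearMap.range (f.toLinearMap.baseChange ℂ))
    (hTN : T N = ⊤) {VD : Fin N → Type x'} [∀ j, AddCommGroup (VD j)] [∀ j, Module ℚ (VD j)]
    (hconj : ∀ j : Fin N, ∀ x ∈ T ((j : ℕ) + 1), conj x ∈ T ((j : ℕ) + 1))
    {HD : ∀ j : Fin N, HodgeStructure (VD j) (k + ((j : ℕ) : ℤ) + 1)}
    (S : ∀ j, HodgeStructure.SubHodgeStructure (HD j)) (Res : ∀ j : Fin N, V →ₗ[ℚ] VD j)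
    (hS : ∀ j : Fin N,
      (S j).toSubmodule.baseChange ℂ = (T ((j : ℕ) + 1)).map ((Res j).baseChange ℂ))
    (hlo : ∀ j : Fin N, ∀ x ∈ T ((j : ℕ) + 1), (Res j).baseChange ℂ x = 0 → x ∈ T j)
    (hL : ∀ (j : Fin N) (p : ℤ), ∀ ξ ∈ (HD j).F p ⊓ (T ((j : ℕ) + 1)).map ((Res j).baseChange ℂ),
      ∃ x ∈ F p ⊓ T ((j : ℕ) + 1), (Res j).baseChange ℂ x = ξ) :
    LinearMap.range φ ≤ LinearMap.range f.toLinearMap := by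
  set W : ℤ → Submodule ℂ (ℂ ⊗[ℚ] V) := fun m ↦ T (min N (m - k).toNat) with hW
  have hWk : W k = T 0 := by
    have h0 : min N (k - k).toNat = 0 := by omega
    simp only [hW]
    rw [h0]
  have hWN : W (k + N) = ⊤ := by
    have h0 : min N (k + (N : ℤ) - k).toNat = N := by omega
    simp only [hW]
    rw [h0, hTN]
  refine range_le_range_of_hodgeType_span_gr f φ W F (by rw [hWk]; exact hT0) hF ?_ (N := N) hWN
  intro m hm
  by_cases hmN : m ≤ k + N
  · -- level `j + 1 ≤ N`: `W m = T (j + 1)`, `W (m - 1) = T j`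
    obtain ⟨j, hj⟩ := Int.eq_ofNat_of_zero_le (show (0 : ℤ) ≤ m - k - 1 by omega)
    have hjN : j < N := by omega
    have hm' : m = k + (j : ℤ) + 1 := by omega
    subst hm'
    have h1 : W (k + (j : ℤ) + 1) = T (j + 1) := by
      have h0 : min N (k + (j : ℤ) + 1 - k).toNat = j + 1 := by omega
      simp only [hW]
      rw [h0]
    have h2 : W (k + (j : ℤ) + 1 - 1) = T j := by
      have h0 : min N (k + (j : ℤ) + 1 - 1 - k).toNat = j := by omega
      simp only [hW]
      rw [h0]
    rw [h1, h2]
    exact hodgeType_span_of_residue_lifts_within (S ⟨j, hjN⟩) (Res ⟨j, hjN⟩) (T (j + 1)) (T j)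
      (hconj ⟨j, hjN⟩) (hS ⟨j, hjN⟩) (hlo ⟨j, hjN⟩) F (hL ⟨j, hjN⟩)
  · -- above the top level: `W (m - 1) = ⊤`
    have h2 : W (m - 1) = ⊤ := by
      have h0 : min N (m - 1 - k).toNat = N := by omega
      simp only [hW]
      rw [h0, hTN]
    rw [h2]
    exact le_sup_of_le_left le_top

end Literature.AlgebraicGeometry.HodgeTheory

end
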